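import Literature.AlgebraicGeometry.Motives.MixedHodgeStructureInternalHom
import HarnessLib

/-!
# Functoriality of the internal Hom of mixed Hodge structures

For morphisms of mixed Hodge structures `f : H₁' → H₁` and `g : H₂ → H₂'` (finite-dimensional
underlying spaces), the map `φ ↦ g ∘ φ ∘ f : Hom(H₁, H₂) → Hom(H₁', H₂')` is a morphism of MHS for
the internal Hom `MixedHodgeStructure.hom` (`Motives/MixedHodgeStructureInternalHom`; Cattani–El
Zein–Griffiths–Lê §3.2.2.7 (1), Deligne, *Hodge II*, 1.1.12: `Hom` and `⊗` are functors of
filtered objects): it is the composite `Hom(H₁,H₂) ≅ H₁^∨ ⊗ H₂ —(ᵗf ⊗ g)→ H₁'^∨ ⊗ H₂' ≅ Hom(H₁',H₂')`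
of the transpose (`Hom.transpose`), the tensor product of morphisms (`Hom.tensorMap`) and the
isomorphisms `Hom ≅ (·)^∨ ⊗ (·)` (`homToTensor`, `tensorToHom`).

## Main results (definitions with bodies and theorems; no named facts)

* `dualTensorHom_map_dualMap` — naturality of `V^∨ ⊗ V' → Hom(V,V')`:
  `dTH((ᵗf ⊗ g) x) = g ∘ dTH(x) ∘ f`;
* **`Hom.homMap f g : Hom (hom H₁ H₂) (hom H₁' H₂')`**, **`Hom.homMap_toLinearMap_apply`**
  (`φ ↦ g ∘ φ ∘ f`), `Hom.homMap_id`, `Hom.homMap_comp`.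

## References

* [CattaniElZeinGriffithsLe2014] E. Cattani et al. (eds.), *Hodge Theory* (2014), §3.2.2.7 (1).
* [DeligneHodgeII1971] P. Deligne, Théorie de Hodge II, 1.1.12.
-/

noncomputable section

open scoped TensorProduct

namespace Literature.AlgebraicGeometry.Motives

namespace MixedHodgeStructure

universe u v u' v' u'' v''

variable {V : Type u} [AddCommGroup V] [Module ℚ V]
variable {V' : Type v} [AddCommGroup V'] [Module ℚ V']
variable {U : Type u'} [AddCommGroup U] [Module ℚ U]
variable {U' : Type v'} [AddCommGroup U'] [Module ℚ U']
variable {X : Type u''} [AddCommGroup X] [Module ℚ X]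
variable {X' : Type v''} [AddCommGroup X'] [Module ℚ X']

open Module

/-- **Naturality of `V^∨ ⊗ V' → Hom(V, V')`**: for `f : U → V`, `g : V' → U'` and `x ∈ V^∨ ⊗ V'`,
`dTH((ᵗf ⊗ g)(x)) = g ∘ dTH(x) ∘ f` (on `ψ ⊗ w` both sides are `u ↦ ψ(f u) • g w`). [folklore] -/
private theorem dualTensorHom_map_dualMap (f : U →ₗ[ℚ] V) (g : V' →ₗ[ℚ] U')
    (x : Module.Dual ℚ V ⊗[ℚ] V') :
    dualTensorHom ℚ U U' (TensorProduct.map f.dualMap g x) =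
      g ∘ₗ dualTensorHom ℚ V V' x ∘ₗ f := by
  induction x using TensorProduct.induction_on with
  | zero => simp only [map_zero, LinearMap.zero_comp, LinearMap.comp_zero]
  | add x y hx hy => simp only [map_add, hx, hy, LinearMap.add_comp, LinearMap.comp_add]
  | tmul ψ w =>
    refine LinearMap.ext fun u => ?_
    rw [TensorProduct.map_tmul, dualTensorHom_apply, LinearMap.dualMap_apply, LinearMap.comp_apply,
      LinearMap.comp_apply, dualTensorHom_apply, map_smul]

variable [FiniteDimensional ℚ V] [FiniteDimensional ℚ V'] [FiniteDimensional ℚ U]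
  [FiniteDimensional ℚ U'] [FiniteDimensional ℚ X] [FiniteDimensional ℚ X']

/-- **`Hom(f, g) : Hom(H₁, H₂) → Hom(H₁', H₂')`, `φ ↦ g ∘ φ ∘ f`, is a morphism of mixed Hodge
structures** for morphisms `f : H₁' → H₁`, `g : H₂ → H₂'` — the composite
`Hom(H₁,H₂) ≅ H₁^∨ ⊗ H₂ —(ᵗf ⊗ g)→ H₁'^∨ ⊗ H₂' ≅ Hom(H₁',H₂')` (Deligne 1.1.12: `Hom` is a functor of
filtered objects). [cite: DeligneHodgeII1971, 1.1.12] [cite: CattaniElZeinGriffithsLe2014, §3.2.2.7] -/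
def Hom.homMap {H₁ : MixedHodgeStructure V} {H₁' : MixedHodgeStructure U} {H₂ : MixedHodgeStructure V'}
    {H₂' : MixedHodgeStructure U'} (f : Hom H₁' H₁) (g : Hom H₂ H₂') :
    Hom (hom H₁ H₂) (hom H₁' H₂') :=
  (tensorToHom H₁' H₂').comp ((f.transpose.tensorMap g).comp (homToTensor H₁ H₂))

/-- **The underlying map of `Hom(f, g)` is `φ ↦ g ∘ φ ∘ f`.** [cite: DeligneHodgeII1971, 1.1.12] -/
@[simp]
theorem Hom.homMap_toLinearMap_apply {H₁ : MixedHodgeStructure V} {H₁' : MixedHodgeStructure U}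
    {H₂ : MixedHodgeStructure V'} {H₂' : MixedHodgeStructure U'} (f : Hom H₁' H₁) (g : Hom H₂ H₂')
    (φ : V →ₗ[ℚ] V') :
    (Hom.homMap f g).toLinearMap φ = g.toLinearMap ∘ₗ φ ∘ₗ f.toLinearMap := by
  rw [Hom.homMap, comp_toLinearMap, comp_toLinearMap, tensorToHom_toLinearMap,
    Hom.tensorMap_toLinearMap, homToTensor_toLinearMap, transpose_toLinearMap, LinearMap.comp_apply,
    LinearMap.comp_apply, LinearEquiv.coe_coe, LinearEquiv.coe_coe]
  have happ : ∀ y : Module.Dual ℚ U ⊗[ℚ] U', dualTensorHomEquiv ℚ U U' y = dualTensorHom ℚ U U' y :=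
    fun y => by rw [dualTensorHomEquiv, dualTensorHomEquivOfBasis_apply]
  have happ' : ∀ y : Module.Dual ℚ V ⊗[ℚ] V', dualTensorHomEquiv ℚ V V' y = dualTensorHom ℚ V V' y :=
    fun y => by rw [dualTensorHomEquiv, dualTensorHomEquivOfBasis_apply]
  rw [happ, dualTensorHom_map_dualMap, ← happ', LinearEquiv.apply_symm_apply]

/-- `Hom(id, id) = id`. [cite: DeligneHodgeII1971, 1.1.12] -/
theorem Hom.homMap_id (H₁ : MixedHodgeStructure V) (H₂ : MixedHodgeStructure V') :
    Hom.homMap (Hom.id H₁) (Hom.id H₂) = Hom.id (hom H₁ H₂) :=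
  Hom.ext (LinearMap.ext fun φ => by
    rw [Hom.homMap_toLinearMap_apply, id_toLinearMap, id_toLinearMap, LinearMap.id_comp, LinearMap.comp_id]
    rfl)

/-- **Functoriality** (contravariant in the source, covariant in the target):
`Hom(f ∘ f', g' ∘ g) = Hom(f', g') ∘ Hom(f, g)`. [cite: DeligneHodgeII1971, 1.1.12] -/
theorem Hom.homMap_comp {H₁ : MixedHodgeStructure V} {H₁' : MixedHodgeStructure U}
    {H₁'' : MixedHodgeStructure X} {H₂ : MixedHodgeStructure V'} {H₂' : MixedHodgeStructure U'}
    {H₂'' : MixedHodgeStructure X'} (f : Hom H₁' H₁) (f' : Hom H₁'' H₁') (g : Hom H₂ H₂')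
    (g' : Hom H₂' H₂'') :
    Hom.homMap (f.comp f') (g'.comp g) = (Hom.homMap f' g').comp (Hom.homMap f g) :=
  Hom.ext (LinearMap.ext fun φ => by
    rw [Hom.homMap_toLinearMap_apply, comp_toLinearMap, comp_toLinearMap, comp_toLinearMap,
      LinearMap.comp_apply, Hom.homMap_toLinearMap_apply, Hom.homMap_toLinearMap_apply]
    rfl)

/-- `Hom(f, g)` is bijective when `f` and `g` are (then it is an isomorphism of MHS).
[cite: CattaniElZeinGriffithsLe2014, Thm. 3.2.18] -/
theorem Hom.homMap_bijective {H₁ : MixedHodgeStructure V} {H₁' : MixedHodgeStructure U}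
    {H₂ : MixedHodgeStructure V'} {H₂' : MixedHodgeStructure U'} (f : Hom H₁' H₁) (g : Hom H₂ H₂')
    (hf : Function.Bijective f.toLinearMap) (hg : Function.Bijective g.toLinearMap) :
    Function.Bijective (Hom.homMap f g).toLinearMap := by
  let ef := LinearEquiv.ofBijective f.toLinearMap hf
  let eg := LinearEquiv.ofBijective g.toLinearMap hg
  have h : (Hom.homMap f g).toLinearMap = ((ef.symm.congrLeft V' ℚ).trans (eg.congrRight)).toLinearMap := by
    refine LinearMap.ext fun φ => ?_
    rw [Hom.homMap_toLinearMap_apply]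
    rfl
  rw [h]
  exact LinearEquiv.bijective _

end MixedHodgeStructure

end Literature.AlgebraicGeometry.Motives

end
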